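import Summits.ABC.IUTFork.Repair.CandInternal2RealLabelsLicenceGenuineK
import Summits.ABC.IUTFork.Repair.CandInternal2RealSharp
import HarnessLib

/-!
# R-H ROUND 1 (D-0107), pair n = 10 — `RHSharpUpperEdge`: the deciding decl H⋆₁₀ «sharp-upper-edge» typed over the genuine `K`-level
# datum `Cor312Prov.pilotDataOfK D K`, its column-currency evaluation lemmas (k1), and its NECESSITY from the real I06⋆ cells (p454995)

DEFINITION + proof file of the abc-iut cell, D-0079 RESCUE sub-cell R-H («local-height condition I06⋆»), rung LADDER-ABC:A2.RESCUE.H;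
seat abc-iut-rh-typ-10 (R-H ROUND 1 PAIR n = 10 TYPER; row 10 of `plan/rescue/R-H/RH-CANDIDATES.tsv`, one writer abc-iut-rh-lead g0).
TAKES NO SIDE on [IUTchIII] Cor. 3.12 or on any author. H⋆₁₀ is a CANDIDATE HYPOTHESIS (a claim-tagged `def … : Prop`), never a
Literature fact; typed ≠ proved; instantiated ≠ endorsed; refuted-as-typed ≠ refuted-in-print; nothing here asserts abc.

ROW 10 (verbatim, `RH-CANDIDATES.tsv` col. `informal_statement`): «I06* read with the EXACT outer radius of log(O^x): forall bad w, j: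
h(w,j) <= kappa_plus_sharp(w) — the sharpest NECESSARY shell-internal capacity; as a candidate it is the last member of the shell family
(rows 7, 10) and its k1 number is the definitive count of shell-decidable cells»; stratum/scope «all packets»; cut class «C3 sharp / G1»;
k1 recipe «slack vs kappa_plus_sharp(p454995) column; i06star_cell_v2 / deciding_decl_v2»; k2 door «none (necessary side)».

CURRENCY (plan/rescue/R-H/START-HERE.md §1–§2). At a bad place `w | p` of the genuine datum `X = pilotDataOfK D K` ([IUTchI] Def. 3.1):
`e = e_w = e(w|p)` (`(placeOf X p w).asIdeal.ramificationIdx ℤ` = `absRamificationIdx p K_w`, abc-iut-S1), `P = P_w = X.qPilot w ∈ ℕ`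
(`= e(w|v)·ord_v(q_v)/(2l)`, the q-pilot degree in `ord_w` units; [IUTchI] Ex. 3.2 (iv), `Cor312Prov.exists_nat_qPilot_pilotDataOfK`),
`c = ord_p(p*) ∈ {1, 2}`, label `j = i+1 ∈ 𝔽_l^⋇`, Kummer exponent `n = j²`; the table's `h(w,j) = (j²−1)·H/(2l) = (j²−1)·P_w/e_w` and
`κ⁺♯(w) = c + a₀ − p^{a₀}/e_w = c − r_out♯/e_w`, `r_out♯ = min_{a ≥ 0}(pᵃ − a·e_w) = p^{a₀} − a₀·e_w` at the turning point `a₀`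
(abc-iut-rp-x2 `CandInternal2RealSharp`, p454995; abc-iut-rh-num-1's column `kappa_plus_sharp` of I06STAR-COLUMNS v2.1).
So «`h(w,j) ≤ κ⁺♯(w)`» ⟺ «`(j²−1)·P_w ≤ c·e_w − min_a(pᵃ − a·e_w)`» ⟺ «`∃ a, (j²−1)·P_w + pᵃ ≤ (c + a)·e_w`» — the last form is the
typed cell `SharpCell p e_w P_w (j²)` (§1), free of turning-point bookkeeping; §1 proves it equal to the column test at the turning point /
on every integer window (`sharpCell_iff_of_turning`, `sharpCell_iff_of_window`, `sharpCell_iff_of_le_sub_one`).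

WHAT IS TYPED / PROVED (namespace `Summit.ABC.IUTFork.Repair.RHSharpUpperEdge`):
* §1 `SharpCell` + its three column evaluations (integer arithmetic; abc-iut-w5's `RamificationCriterion.exponent_min`);
  `printCell_of_sharpCell` — H⋆₁₀'s cell implies row 7's cell `(j²−1)·P ≤ e·(b_e + c)` (`sharp_le_print`), so row 10 ⊆ row 7 cellwise.
* §2 **`HStarSharpUpperEdge D`** — H⋆₁₀ at the genuine datum: every bad place `w | p`, every label `j ∈ 𝔽_l^⋇`: `SharpCell p e_w P_w (j²)`.
* §3 **`sharpCell_of_mem_pow_smul_logShell`** — for q-ideles REALISING the q-pilot divisor (`‖t_{q,w}‖ = p^{−P_w/e_w}`, abc-iut-w5-d236), the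
  real I06⋆-type cell `t_{q,w} ∈ t_{q,w}^{n}·ℐ_{K_w}` forces `SharpCell p e_w P_w n` (p454995 `height_le_of_mem_pow_smul_logShell_sharp` + the
  turning point `exists_turning`); hence **`hStar_of_realStar`**: the real I06⋆ cells at every bad place and label ⟹ H⋆₁₀ (H⋆₁₀ is NECESSARY
  for I06⋆ as typed on the real shell — row 10's «necessary side»), and the deciding direction used by k1:
  **`not_mem_pow_smul_logShell_of_not_sharpCell`** / `not_mem_pow_smul_logShell_of_window_lt` (a cell failing the column test is a
  DECIDED-NEG I06⋆ cell, deciding decl p454995) and `not_realStar_of_not_hStar`.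
* §4 worked cells of the table of record (arithmetic anchors for k1; `(p, e_w, P_w, j)` as in I06STAR-COLUMNS).
HONEST SCOPE: H⋆₁₀ is a NECESSARY condition for the real I06⋆ cells; nothing here claims it sufficient for the (xi-f) licence / S_H (k2 door
«none» per the row); between `κ^in` and `κ⁺♯` a cell is ELEMENT-OPEN (START-HERE §1) and H⋆₁₀ does not decide it. [cite: MochizukiAbsTopIII2015,
Def 5.4 (iii) p. 126] [cite: Mochizuki2012, IUTchI Def. 3.1 (b),(c) pp. 61–62, Ex. 3.2 (iv) p. 71; IUTchIV Prop. 1.2 (i) p. 10]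
[cite: NeukirchANT1999, Ch. II (5.5)] [cite: DupuyHilado2025, §3.3, §3.4] [claim: Mochizuki2012, status: disputed] for every IUT sentence quoted.
Axioms: standard.
-/

noncomputable section

open Set Metric Function NumberField IsDedekindDomain
open scoped Pointwise

namespace Summit.ABC.IUTFork.Repair.RHSharpUpperEdge

open Literature.AnabelianGeometry.AbsoluteAnabelian Literature.IUT.LogThetaLattice Literature.IUT.LogVolume
  Literature.IUT.LogVolume.RamificationCriterion Literature.IUT.HodgeTheaters Literature.NumberTheory.NumberFields
  Literature.NumberTheory.GaloisRepresentations.Ultrametric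
open Summit.ABC.IUTFork.Thm311 Summit.ABC.IUTFork.Thm311.Real Summit.ABC.IUTFork.Cor312Prov
  Summit.ABC.IUTFork.Repair.CandInternal2RealLabels Summit.ABC.IUTFork.Repair.CandInternal2RealSharp

/-! ## §1. The H⋆₁₀ cell in the column currency of `I06STAR-COLUMNS.tsv` -/

/-- **The H⋆₁₀ («sharp-upper-edge») CELL in integer `ord_w` units**: for a prime `p`, ramification index `e = e_w`, q-pilot degree
`P = P_w` and Kummer exponent `n` (`n = j²` for the I06⋆ cell at label `j`), `SharpCell p e P n :⟺ ∃ a, (n−1)·P + pᵃ ≤ (c + a)·e`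
(`c = ord_p(p*)`), i.e. `(n−1)·P/e ≤ max_a (c + a − pᵃ/e) = κ⁺♯` — row 10's «h(w,j) ≤ κ⁺♯(w)». [R-H candidate, hypothesis — not a fact]
[claim: Mochizuki2012, status: disputed] -/
@[claim "Mochizuki2012" "disputed"]
def SharpCell (p e P n : ℕ) : Prop :=
  ∃ a : ℕ, ((n : ℤ) - 1) * P + (p : ℤ) ^ a ≤ (((if p = 2 then 2 else 1 : ℕ) : ℤ) + a) * e

/-- **Column evaluation at the turning point**: if `a₀` is the turning point of `e` at `p` (`pᵃ(p−1) < e` for `a < a₀`, `e ≤ p^{a₀}(p−1)`),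
then `SharpCell p e P n ⟺ (n−1)·P + p^{a₀} ≤ (c + a₀)·e`, i.e. `(n−1)·P ≤ e·κ⁺♯` (abc-iut-w5's `exponent_min`: `p^{a₀} − a₀·e ≤ pᵃ − a·e`).
[cite: NeukirchANT1999, Ch. II (5.5)] -/
theorem sharpCell_iff_of_turning {p e P n a₀ : ℕ} (hp : 2 ≤ p)
    (hlo : ∀ a < a₀, (1 : ℤ) * (p : ℤ) ^ a * ((p : ℤ) - 1) < e) (hhi : (e : ℤ) ≤ 1 * (p : ℤ) ^ a₀ * ((p : ℤ) - 1)) :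
    SharpCell p e P n ↔ ((n : ℤ) - 1) * P + (p : ℤ) ^ a₀ ≤ (((if p = 2 then 2 else 1 : ℕ) : ℤ) + a₀) * e := by
  refine ⟨?_, fun h => ⟨a₀, h⟩⟩
  rintro ⟨a, ha⟩
  have hP : (2 : ℤ) ≤ (p : ℤ) := by exact_mod_cast hp
  have hmin := exponent_min (S := (1 : ℤ)) (P := (p : ℤ)) (E := (e : ℤ)) (a₀ := a₀) le_rfl hP hlo hhi a
  linarith

/-- **Column evaluation on an integer window**: `k ≥ 1`, `p^{k−1}(p−1) < e ≤ p^k(p−1)` ⟹ `SharpCell p e P n ⟺ (n−1)·P + p^k ≤ (c + k)·e`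
(p454995 `turning_of_window`). [cite: NeukirchANT1999, Ch. II (5.5)] -/
theorem sharpCell_iff_of_window {p e P n k : ℕ} (hp : p.Prime) (hk : 1 ≤ k) (hlo : p ^ (k - 1) * (p - 1) < e)
    (hhi : e ≤ p ^ k * (p - 1)) :
    SharpCell p e P n ↔ ((n : ℤ) - 1) * P + (p : ℤ) ^ k ≤ (((if p = 2 then 2 else 1 : ℕ) : ℤ) + k) * e := by
  haveI : Fact p.Prime := ⟨hp⟩
  have hw := turning_of_window p hk hlo hhi
  exact sharpCell_iff_of_turning hp.two_le hw.1 hw.2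

/-- **Column evaluation for `e ≤ p − 1`** (the tame range and the boundary `e = p − 1`; turning point `a₀ = 0`):
`SharpCell p e P n ⟺ (n−1)·P + 1 ≤ c·e`. [cite: NeukirchANT1999, Ch. II (5.5)] -/
theorem sharpCell_iff_of_le_sub_one {p e P n : ℕ} (hp : p.Prime) (he : e ≤ p - 1) :
    SharpCell p e P n ↔ ((n : ℤ) - 1) * P + 1 ≤ (((if p = 2 then 2 else 1 : ℕ) : ℤ)) * e := by
  haveI : Fact p.Prime := ⟨hp⟩
  have hw := turning_zero_of_le p he
  have h := sharpCell_iff_of_turning (P := P) (n := n) hp.two_le hw.1 hw.2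
  simpa using h

/-- **Row 10 ⊆ row 7 cellwise**: `SharpCell p e P n ⟹ (n−1)·P ≤ e·(b_e + c)` (print's necessary edge `κ⁺ = b_e + c`, row 7
«shell-capacity-plus»), by p454995 `sharp_le_print` (`κ⁺♯ ≤ κ⁺`). [cite: Mochizuki2012, IUTchIV Prop. 1.2 (i) p. 10] -/
theorem printCell_of_sharpCell {p e P n : ℕ} (hp : p.Prime) (he : 1 ≤ e) (h : SharpCell p e P n) :
    ((n : ℝ) - 1) * P ≤ e * (logRadiusB p e + ((if p = 2 then 2 else 1 : ℕ) : ℝ)) := by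
  haveI : Fact p.Prime := ⟨hp⟩
  obtain ⟨a₀, hlo, hhi⟩ := exists_turning p e
  have hcell := (sharpCell_iff_of_turning hp.two_le hlo hhi).1 h
  have hsp := sharp_le_print p he hlo (((if p = 2 then 2 else 1 : ℕ) : ℝ))
  have he' : (0 : ℝ) < e := by exact_mod_cast he
  have hcellR : ((n : ℝ) - 1) * P + (p : ℝ) ^ a₀ ≤ ((((if p = 2 then 2 else 1 : ℕ) : ℝ)) + a₀) * e := by exact_mod_cast hcell
  have hmul := mul_le_mul_of_nonneg_left hsp he'.le
  have hexp : (e : ℝ) * ((((if p = 2 then 2 else 1 : ℕ) : ℝ)) + a₀ - (p : ℝ) ^ a₀ / (e : ℝ)) =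
      ((((if p = 2 then 2 else 1 : ℕ) : ℝ)) + a₀) * e - (p : ℝ) ^ a₀ := by
    field_simp
  rw [hexp] at hmul
  linarith

/-! ## §2. The deciding decl H⋆₁₀ at the genuine `K`-level datum -/

variable {F K Fbar : Type} [Field F] [NumberField F] [Field K] [NumberField K] [Algebra F K] [Field Fbar]
  [Algebra F Fbar] [Algebra K Fbar] {E : WeierstrassCurve F} [E.IsElliptic] {l : ℕ} {Pb : BadPlacePredicates K}
  (D : InitialThetaData F K Fbar E l Pb)

/-- **H⋆₁₀ «sharp-upper-edge» (R-H ROUND 1 row 10) at the genuine `K`-level datum `pilotDataOfK D K`** of an initial Θ-datum `D`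
([IUTchI] Def. 3.1): «I06⋆ read with the EXACT outer radius of `log_p(𝒪^×_{K_w})`: for every bad place `w | p` and every label
`j = i+1 ∈ 𝔽_l^⋇`, `h(w,j) ≤ κ⁺♯(w)`», i.e. `SharpCell p e_w P_w (j²)` with `e_w = e(w|p)` and `P_w = qPilot w ∈ ℕ` (the q-pilot degree;
`Cor312Prov.exists_nat_qPilot_pilotDataOfK`). The sharpest NECESSARY shell-internal capacity test (§3: implied by the real I06⋆ cells).
[R-H candidate, hypothesis — not a fact] [cite: Mochizuki2012, IUTchI Def. 3.1 (b),(c) pp. 61–62, Ex. 3.2 (iv) p. 71]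
[cite: MochizukiAbsTopIII2015, Def 5.4 (iii) p. 126] [claim: Mochizuki2012, status: disputed] -/
@[claim "Mochizuki2012" "disputed"]
def HStarSharpUpperEdge : Prop :=
  ∀ (pp : Nat.Primes) (i : Fin (pilotDataOfK D K).lstar) (w : (thetaIndex (pilotDataOfK D K)).Fibre (.inr pp)),
    haveI : Fact (pp : ℕ).Prime := ⟨pp.2⟩
    placeOf (pilotDataOfK D K) pp.1 w ∈ (pilotDataOfK D K).S →
      ∀ P : ℕ, (pilotDataOfK D K).qPilot (placeOf (pilotDataOfK D K) pp.1 w) = P →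
        SharpCell (pp : ℕ) ((placeOf (pilotDataOfK D K) pp.1 w).asIdeal.ramificationIdx ℤ) P (((i : ℕ) + 1) ^ 2)

/-! ## §3. Necessity: the real I06⋆ cells of a realising q-idele force H⋆₁₀; the contrapositive decides NEG cells -/

variable
  (tq : ∀ (pp : Nat.Primes) (x : (thetaIndex (pilotDataOfK D K)).Fibre (.inr pp)),
    haveI : Fact (pp : ℕ).Prime := ⟨pp.2⟩; kOf (pilotDataOfK D K) pp.1 x)
  (htq0 : ∀ pp x, tq pp x ≠ 0)
  (htq : ∀ (pp : Nat.Primes) (x : (thetaIndex (pilotDataOfK D K)).Fibre (.inr pp)),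
    haveI : Fact (pp : ℕ).Prime := ⟨pp.2⟩
    Real.log ‖tq pp x‖ = -((pilotDataOfK D K).qPilot (placeOf (pilotDataOfK D K) pp.1 x)) *
      logNorm K (placeOf (pilotDataOfK D K) pp.1 x) / localDegree K (placeOf (pilotDataOfK D K) pp.1 x))

include htq0 htq in
/-- **REAL SHELL CELL ⟹ H⋆₁₀ CELL (per place and exponent).** For a q-idele realising the q-pilot divisor of `pilotDataOfK D K`
(`‖t_{q,w}‖ = p^{−P_w/e_w}`, abc-iut-w5-d236 `norm_qIdele_eq_rpow_of_realises`) with `P_w = P ∈ ℕ`: if `t_{q,w} ∈ t_{q,w}^{n}·ℐ_{K_w}`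
(`ℐ_{K_w} = (p*)⁻¹·log_p(𝒪^×_{K_w})`, the REAL log-shell), then `SharpCell p e_w P n` — p454995 `height_le_of_mem_pow_smul_logShell_sharp`
at the turning point of `e_w` (`exists_turning`), multiplied out by `e_w`. [cite: MochizukiAbsTopIII2015, Def 5.4 (iii) p. 126]
[cite: NeukirchANT1999, Ch. II (5.5)] [cite: DupuyHilado2025, §3.4] [claim: Mochizuki2012, status: disputed] -/
theorem sharpCell_of_mem_pow_smul_logShell (pp : Nat.Primes) (w : (thetaIndex (pilotDataOfK D K)).Fibre (.inr pp))
    {P : ℕ} (hP : haveI : Fact (pp : ℕ).Prime := ⟨pp.2⟩; (pilotDataOfK D K).qPilot (placeOf (pilotDataOfK D K) pp.1 w) = P) {n : ℕ}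
    (hmem : haveI : Fact (pp : ℕ).Prime := ⟨pp.2⟩
      tq pp w ∈ tq pp w ^ n • logShell (PadicLogOnUnits.ofUnitLog (pp : ℕ) (kOf (pilotDataOfK D K) pp.1 w))) :
    haveI : Fact (pp : ℕ).Prime := ⟨pp.2⟩
    SharpCell (pp : ℕ) ((placeOf (pilotDataOfK D K) pp.1 w).asIdeal.ramificationIdx ℤ) P n := by
  haveI hF : Fact (pp : ℕ).Prime := ⟨pp.2⟩
  have heK : absRamificationIdx (pp : ℕ) (kOf (pilotDataOfK D K) pp.1 w) =
      (placeOf (pilotDataOfK D K) pp.1 w).asIdeal.ramificationIdx ℤ :=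
    absRamificationIdx_rescaledCompletion K (pp : ℕ) (placeOf (pilotDataOfK D K) pp.1 w)
      (natCast_mem_placeOf (pilotDataOfK D K) pp.1 w)
  obtain ⟨a₀, hlo, hhi⟩ := exists_turning (pp : ℕ) (absRamificationIdx (pp : ℕ) (kOf (pilotDataOfK D K) pp.1 w))
  have hramF : (ramIdx K (placeOf (pilotDataOfK D K) pp.1 w) : ℝ) =
      (absRamificationIdx (pp : ℕ) (kOf (pilotDataOfK D K) pp.1 w) : ℝ) := by
    rw [ramIdx_eq K (placeOf (pilotDataOfK D K) pp.1 w), heK]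
  have hqh : ‖tq pp w‖ = ((pp : ℕ) : ℝ) ^
      (-((P : ℝ) / (absRamificationIdx (pp : ℕ) (kOf (pilotDataOfK D K) pp.1 w) : ℝ))) := by
    rw [norm_qIdele_eq_rpow_of_realises (pilotDataOfK D K) tq htq0 htq pp w, hP, hramF, neg_div]
  have hle := height_le_of_mem_pow_smul_logShell_sharp (pp : ℕ) (kOf (pilotDataOfK D K) pp.1 w) hlo hhi hqh hmem
  have he0 : (0 : ℝ) < (absRamificationIdx (pp : ℕ) (kOf (pilotDataOfK D K) pp.1 w) : ℝ) := by
    exact_mod_cast absRamificationIdx_pos (pp : ℕ) (kOf (pilotDataOfK D K) pp.1 w)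
  rw [← mul_div_assoc, div_le_iff₀ he0] at hle
  have hcancel : ((pp : ℕ) : ℝ) ^ a₀ / (absRamificationIdx (pp : ℕ) (kOf (pilotDataOfK D K) pp.1 w) : ℝ) *
      (absRamificationIdx (pp : ℕ) (kOf (pilotDataOfK D K) pp.1 w) : ℝ) = ((pp : ℕ) : ℝ) ^ a₀ :=
    div_mul_cancel₀ _ he0.ne'
  refine ⟨a₀, ?_⟩
  rw [← heK]
  have key : ((n : ℝ) - 1) * P + ((pp : ℕ) : ℝ) ^ a₀ ≤
      ((((if (pp : ℕ) = 2 then 2 else 1 : ℕ) : ℝ)) + a₀) * (absRamificationIdx (pp : ℕ) (kOf (pilotDataOfK D K) pp.1 w) : ℝ) := by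
    linarith
  exact_mod_cast key

include htq0 htq in
/-- **THE REAL I06⋆ CELLS FORCE H⋆₁₀** (row 10's «necessary side»): for q-ideles realising the q-pilot divisor of the genuine datum, if at
every bad place `w | p` and every label `j = i+1 ∈ 𝔽_l^⋇` the real I06⋆ cell `t_{q,w} ∈ t_{q,w}^{j²}·ℐ_{K_w}` holds (abc-iut-rp-d2's reading of
RP-I06⋆, `CandInternal11Gap.HQShellOrbitStar` at data level), then `HStarSharpUpperEdge D`. [cite: MochizukiAbsTopIII2015, Def 5.4 (iii) p. 126]
[cite: Mochizuki2012, IUTchI Ex. 3.2 (iv) p. 71] [claim: Mochizuki2012, status: disputed] -/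
theorem hStar_of_realStar
    (hstar : ∀ (pp : Nat.Primes) (i : Fin (pilotDataOfK D K).lstar) (w : (thetaIndex (pilotDataOfK D K)).Fibre (.inr pp)),
      haveI : Fact (pp : ℕ).Prime := ⟨pp.2⟩
      placeOf (pilotDataOfK D K) pp.1 w ∈ (pilotDataOfK D K).S →
        tq pp w ∈ tq pp w ^ (((i : ℕ) + 1) ^ 2) • logShell (PadicLogOnUnits.ofUnitLog (pp : ℕ) (kOf (pilotDataOfK D K) pp.1 w))) :
    HStarSharpUpperEdge D := fun pp i w hw _ hP =>
  sharpCell_of_mem_pow_smul_logShell D tq htq0 htq pp w hP (hstar pp i w hw)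

include htq0 htq in
/-- **DECIDING DIRECTION (k1): a cell failing H⋆₁₀ is a DECIDED-NEG real I06⋆ cell.** `¬ SharpCell p e_w P_w n ⟹ t_{q,w} ∉ t_{q,w}^{n}·ℐ_{K_w}`
(deciding decl of record: p454995 `CandInternal2RealSharp.not_mem_root_of_lt_sharp` / `not_mem_of_lt_sharp_of_window`).
[cite: MochizukiAbsTopIII2015, Def 5.4 (iii) p. 126] [claim: Mochizuki2012, status: disputed] -/
theorem not_mem_pow_smul_logShell_of_not_sharpCell (pp : Nat.Primes) (w : (thetaIndex (pilotDataOfK D K)).Fibre (.inr pp))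
    {P : ℕ} (hP : haveI : Fact (pp : ℕ).Prime := ⟨pp.2⟩; (pilotDataOfK D K).qPilot (placeOf (pilotDataOfK D K) pp.1 w) = P) {n : ℕ}
    (hnot : haveI : Fact (pp : ℕ).Prime := ⟨pp.2⟩
      ¬ SharpCell (pp : ℕ) ((placeOf (pilotDataOfK D K) pp.1 w).asIdeal.ramificationIdx ℤ) P n) :
    haveI : Fact (pp : ℕ).Prime := ⟨pp.2⟩
    tq pp w ∉ tq pp w ^ n • logShell (PadicLogOnUnits.ofUnitLog (pp : ℕ) (kOf (pilotDataOfK D K) pp.1 w)) :=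
  fun hmem => hnot (sharpCell_of_mem_pow_smul_logShell D tq htq0 htq pp w hP hmem)

include htq0 htq in
/-- **DECIDED-NEG BY THE COLUMN TEST ON AN INTEGER WINDOW**: `k ≥ 1`, `p^{k−1}(p−1) < e_w ≤ p^k(p−1)` and `(c + k)·e_w < (n−1)·P_w + p^k`
⟹ `t_{q,w} ∉ t_{q,w}^{n}·ℐ_{K_w}` (the table's «slack vs kappa_plus_sharp < 0» in `ord_w` units). [cite: NeukirchANT1999, Ch. II (5.5)]
[claim: Mochizuki2012, status: disputed] -/
theorem not_mem_pow_smul_logShell_of_window_lt (pp : Nat.Primes) (w : (thetaIndex (pilotDataOfK D K)).Fibre (.inr pp))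
    {P : ℕ} (hP : haveI : Fact (pp : ℕ).Prime := ⟨pp.2⟩; (pilotDataOfK D K).qPilot (placeOf (pilotDataOfK D K) pp.1 w) = P) {n k : ℕ}
    (hk : 1 ≤ k)
    (hlo : haveI : Fact (pp : ℕ).Prime := ⟨pp.2⟩
      (pp : ℕ) ^ (k - 1) * ((pp : ℕ) - 1) < (placeOf (pilotDataOfK D K) pp.1 w).asIdeal.ramificationIdx ℤ)
    (hhi : haveI : Fact (pp : ℕ).Prime := ⟨pp.2⟩
      (placeOf (pilotDataOfK D K) pp.1 w).asIdeal.ramificationIdx ℤ ≤ (pp : ℕ) ^ k * ((pp : ℕ) - 1))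
    (hlt : haveI : Fact (pp : ℕ).Prime := ⟨pp.2⟩
      (((if (pp : ℕ) = 2 then 2 else 1 : ℕ) : ℤ) + k) * ((placeOf (pilotDataOfK D K) pp.1 w).asIdeal.ramificationIdx ℤ : ℕ) <
        ((n : ℤ) - 1) * P + ((pp : ℕ) : ℤ) ^ k) :
    haveI : Fact (pp : ℕ).Prime := ⟨pp.2⟩
    tq pp w ∉ tq pp w ^ n • logShell (PadicLogOnUnits.ofUnitLog (pp : ℕ) (kOf (pilotDataOfK D K) pp.1 w)) :=
  not_mem_pow_smul_logShell_of_not_sharpCell D tq htq0 htq pp w hP fun h =>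
    (not_le.2 hlt) ((sharpCell_iff_of_window pp.2 hk hlo hhi).1 h)

include htq0 htq in
/-- **`¬H⋆₁₀ ⟹ ¬(real I06⋆ at every bad place and label)`** — the datum-level deciding direction (contrapositive of `hStar_of_realStar`).
[claim: Mochizuki2012, status: disputed] -/
theorem not_realStar_of_not_hStar (h : ¬ HStarSharpUpperEdge D) :
    ¬ ∀ (pp : Nat.Primes) (i : Fin (pilotDataOfK D K).lstar) (w : (thetaIndex (pilotDataOfK D K)).Fibre (.inr pp)),
      haveI : Fact (pp : ℕ).Prime := ⟨pp.2⟩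
      placeOf (pilotDataOfK D K) pp.1 w ∈ (pilotDataOfK D K).S →
        tq pp w ∈ tq pp w ^ (((i : ℕ) + 1) ^ 2) • logShell (PadicLogOnUnits.ofUnitLog (pp : ℕ) (kOf (pilotDataOfK D K) pp.1 w)) :=
  fun hstar => h (hStar_of_realStar D tq htq0 htq hstar)

/-! ## §4. Worked cells of the table of record (arithmetic anchors; `(p, e_w, P_w, j)`, odd `p` so `c = 1`) -/

/-- `lamSeven:k=1:l=11@p7.j5` / `HEX:1:11@p7.j5.ev1` (`p = 7`, `e_w = 11`, `P_w = e_w·H/(2l) = 1`, `j = 5`, `n = 25`): window `k = 1`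
(`6 < 11 ≤ 42`), `24·1 + 7 = 31 > (1+1)·11 = 22` ⟹ the H⋆₁₀ cell FAILS (`κ⁺♯ = 15/11 < h = 24/11`). -/
example : ¬ SharpCell 7 11 1 25 := by
  rw [sharpCell_iff_of_window (k := 1) (by norm_num) le_rfl (by norm_num) (by norm_num)]
  norm_num

/-- Same place, label `j = 2` (`n = 4`): `3·1 + 7 = 10 ≤ 22` ⟹ the H⋆₁₀ cell HOLDS (witness `a = 1`). -/
example : SharpCell 7 11 1 4 := ⟨1, by norm_num⟩

/-- A tame cell, `(p, e_w, P_w, j) = (7, 5, 2, 2)` (`HEX:2:5@p7.j2.ev1`): `e_w ≤ p − 1`, `3·2 + 1 = 7 > 1·5` ⟹ the H⋆₁₀ cell FAILS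
(`κ⁺♯ = 1 − 1/5 = 4/5 < h = 6/5`). -/
example : ¬ SharpCell 7 5 2 4 := by
  rw [sharpCell_iff_of_le_sub_one (by norm_num) (by norm_num)]
  norm_num

end Summit.ABC.IUTFork.Repair.RHSharpUpperEdge

end
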